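import Mathlib
import Literature.MathematicalPhysics.QuantumFieldTheory.ConstructiveQFTWave0Proofs
import Summits.QuantumFields.QCD.Theorems.QuarksAsStableActionUnquenchedChessboardBoundLinkGramMirror
import Summits.QuantumFields.QCD.Theorems.QuarksAsStableActionUnquenchedChessboardBoundStubShiftZb
import HarnessLib

/-!
# Link Gram identity, part 5: the twisted lifted field of the temporal gauge
(crux stmt-QuantumFields-9735, line `Sketch`, lead's stub `linkGram`)

In the temporal gauge on the two crossing layers (`z = splice crossEdges (U, 1)`) the antiperiodic
quark determinant is the determinant of the chiral-basis diluted operator in the `U(3)` field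
`linkField U := apTwistAt linkSeam (unitaryLift z)`, whose time seam is moved from the slice `-1`
onto the UPPER crossing layer `L/2 → L/2 + 1` (seam independence of `det`,
`ShiftZb.det_bondWilsonDirac_apTwistAt`): `det_bondWilsonDiracAP_splice`. The point of this choice:
the link reflection then commutes with the lift EXACTLY, `Θ (linkField U) = linkField (Θ U)`
(`timeReflect_linkField`, `L` even), and `linkField U = 1` on the lower crossing layer
(`linkField_apply_lowerCross`). All statements are proved.
-/

noncomputable section

open Matrix Complex Finset
open Literature.MathematicalPhysics.QuantumFieldTheory Literature.MathematicalPhysics.QuantumLattice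
open Literature.Probability.LatticeModels (TorusSite)
open Summit.QuantumFields.QCD.Theorems.QuarksAsStableAction
open scoped ComplexConjugate BigOperators

namespace Summit.QuantumFields.QCD.Theorems.UnquenchedChessboardBoundLine

variable {L N : ℕ} [NeZero L]

/-- The seams of the twisted lift: the time seam on the slice `L/2` (the upper crossing layer), the
spatial seams on the slices `-1` (as for `apLift`). -/
def linkSeam (L : ℕ) [NeZero L] : Fin 4 → ZMod L :=
  Function.update (fun _ => -1) 0 ((L / 2 : ℕ) : ZMod L)

/-- **The twisted lifted field of the temporal gauge**: crossing links set to `1`, lifted to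
`U(N)`, antiperiodic seams at `linkSeam`. -/
def linkField (U : GaugeConfig 4 L (Matrix.specialUnitaryGroup (Fin N) ℂ)) :
    GaugeConfig 4 L (Matrix.unitaryGroup (Fin N) ℂ) :=
  apTwistAt (linkSeam L) (unitaryLift (LatticeRP.splice WilsonRP.crossEdges (U, 1)))

/-- Unfolding `linkField` on an edge. -/
theorem linkField_apply (U : GaugeConfig 4 L (Matrix.specialUnitaryGroup (Fin N) ℂ)) (e : Edge 4 L) :
    linkField U e =
      if e.1 e.2 = linkSeam L e.2 then
        -suInclusion (N := N) (if e ∈ WilsonRP.crossEdges then 1 else U e)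
      else suInclusion (N := N) (if e ∈ WilsonRP.crossEdges then 1 else U e) := by
  simp only [linkField, apTwistAt_apply, unitaryLift_apply, LatticeRP.splice_apply]
  rfl

/-- **The antiperiodic determinant in the temporal gauge is the chiral-basis determinant in the
twisted lifted field** (seam independence + change of spin basis). -/
theorem det_bondWilsonDiracAP_splice (E : Finset (Edge 4 L))
    (U : GaugeConfig 4 L (Matrix.specialUnitaryGroup (Fin N) ℂ)) (m : ℝ) :
    (bondWilsonDiracAP E (LatticeRP.splice WilsonRP.crossEdges (U, 1)) m).det =
      (bondWilsonDiracG (unitaryFundamentalRep (Fin N) ℂ) chiralGamma E (linkField U) m 1).det := by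
  rw [det_bondWilsonDiracG_chiral, bondWilsonDiracAP, apLift_eq_apTwistAt, linkField,
    ShiftZb.det_bondWilsonDirac_apTwistAt E (fun _ => -1) (linkSeam L)]

/-- On the lower crossing layer (`t = 0`) the twisted lifted field is `1` (`4 ≤ L`). -/
theorem linkField_apply_lowerCross (h4 : 4 ≤ L) (U : GaugeConfig 4 L (Matrix.specialUnitaryGroup (Fin N) ℂ))
    (x : TorusSite 4 L) (hx : (x 0).val = 0) : linkField U (x, 0) = 1 := by
  rw [linkField_apply]
  have hx0 : x 0 = 0 := (ZMod.val_eq_zero _).1 hx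
  have hseam : ¬ x 0 = linkSeam L 0 := by
    intro h
    simp only [linkSeam, Function.update_self] at h
    have := congrArg ZMod.val h
    rw [hx, ZMod.val_natCast, Nat.mod_eq_of_lt (by omega)] at this
    omega
  have hc : ((x, (0 : Fin 4)) : Edge 4 L) ∈ WilsonRP.crossEdges := by
    rw [WilsonRP.mem_crossEdges]
    exact ⟨rfl, Or.inl hx⟩
  simp only [hseam, ↓reduceIte, hc, map_one]

omit [NeZero L] in
/-- `-(L/2) = L/2` in `ZMod L` for even `L`. -/
theorem neg_half_eq_half (hL : Even L) : -(((L / 2 : ℕ) : ZMod L)) = ((L / 2 : ℕ) : ZMod L) := by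
  rw [neg_eq_iff_add_eq_zero, ← Nat.cast_add, show L / 2 + L / 2 = L by obtain ⟨r, hr⟩ := hL; omega,
    ZMod.natCast_self]

/-- **The link reflection commutes with the twisted lift**: `Θ (linkField U) = linkField (Θ U)`
(`L` even: the time seam `L/2 → L/2+1` is mapped to itself, the spatial seams are untouched, the
crossing layers are mapped to themselves). -/
theorem timeReflect_linkField (hL : Even L) (U : GaugeConfig 4 L (Matrix.specialUnitaryGroup (Fin N) ℂ)) :
    (linkField U).timeReflect = linkField U.timeReflect := by
  funext e
  obtain ⟨x, μ⟩ := e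
  rw [WilsonRP.timeReflect_apply, linkField_apply, linkField_apply]
  by_cases hμ : μ = 0
  · subst hμ
    simp only [↓reduceIte]
    -- the reflected temporal edge
    have hedge : WilsonRP.edgeReflect ((x, (0 : Fin 4)) : Edge 4 L) =
        (Site.timeReflect (Site.shift x 0), (0 : Fin 4)) := by
      unfold WilsonRP.edgeReflect; simp
    rw [hedge]
    simp only
    -- the seam condition is reflection invariant
    have hseam : (Site.timeReflect (Site.shift x 0)) 0 = linkSeam L 0 ↔ x 0 = linkSeam L 0 := by
      simp only [linkSeam, Function.update_self, WilsonRP.timeReflect_apply_zero,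
        WilsonRP.shift_apply_self]
      constructor
      · intro h
        have : x 0 = -(1 - (x 0 + 1)) := by ring
        rw [this, h, neg_half_eq_half hL]
      · intro h
        rw [h, show (1 : ZMod L) - (((L / 2 : ℕ) : ZMod L) + 1) = -(((L / 2 : ℕ) : ZMod L)) by ring,
          neg_half_eq_half hL]
    -- the crossing condition is reflection invariant
    have hcross : ((Site.timeReflect (Site.shift x 0), (0 : Fin 4)) : Edge 4 L) ∈ WilsonRP.crossEdges ↔
        ((x, (0 : Fin 4)) : Edge 4 L) ∈ WilsonRP.crossEdges := by
      rw [← hedge]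
      simp only [WilsonRP.mem_crossEdges]
      constructor
      · intro h
        have := WilsonRP.isCrossEdge_edgeReflect hL h
        rwa [WilsonRP.edgeReflect_edgeReflect] at this
      · exact WilsonRP.isCrossEdge_edgeReflect hL
    -- the value of `Θ U` on the temporal edge
    have hΘ : U.timeReflect (x, 0) = (U (Site.timeReflect (Site.shift x 0), 0))⁻¹ := by
      rw [WilsonRP.timeReflect_apply, if_pos rfl, hedge]
    simp only [hseam, hcross, hΘ]
    by_cases hs : x 0 = linkSeam L 0
    · simp only [hs, ↓reduceIte, unitary_neg_inv]
      split_ifs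
      · simp
      · rw [map_inv]
    · simp only [hs, ↓reduceIte]
      split_ifs
      · simp
      · rw [map_inv]
  · simp only [hμ, ↓reduceIte]
    have hedge : WilsonRP.edgeReflect ((x, μ) : Edge 4 L) = (Site.timeReflect x, μ) := by
      unfold WilsonRP.edgeReflect; simp [hμ]
    rw [hedge]
    simp only [WilsonRP.timeReflect_apply_of_ne _ hμ]
    have hcross : ((Site.timeReflect x, μ) : Edge 4 L) ∉ WilsonRP.crossEdges := by
      rw [WilsonRP.mem_crossEdges]; exact fun h => hμ h.1
    have hcross' : ((x, μ) : Edge 4 L) ∉ WilsonRP.crossEdges := by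
      rw [WilsonRP.mem_crossEdges]; exact fun h => hμ h.1
    have hΘ : U.timeReflect (x, μ) = U (Site.timeReflect x, μ) := by
      rw [WilsonRP.timeReflect_apply, if_neg hμ, hedge]
    simp only [hcross, hcross', ↓reduceIte, hΘ]

/-- **On positive-time edges the twisted lifted field sees the edge itself**: for a non-crossing
edge `e` off the time seam... stated as: `linkField U e` depends only on `U e` for `e ∉ crossEdges`. -/
theorem linkField_congr {U V : GaugeConfig 4 L (Matrix.specialUnitaryGroup (Fin N) ℂ)} {e : Edge 4 L}
    (h : U e = V e) : linkField U e = linkField V e := by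
  rw [linkField_apply, linkField_apply, h]

end Summit.QuantumFields.QCD.Theorems.UnquenchedChessboardBoundLine

end
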